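import Literature.NumberTheory.Rogawski1990.LocalIrreducibleTorusDiscriminantOdd          -- ★ odd-`disc` FILE β (brings ★ ED. 2 `exists_irredExponents`)
import Literature.NumberTheory.Rogawski1990.FinExplicitTransferFactorResiduallyRegular    -- ★ A-p06: `charpoly_map_endoEmbLocal_apply` (`χ_{ι(γ_H),w} = χ_{g,w}·(X − u_w)`)
import HarnessLib

/-!
# The type-(2) exponent stub of the inert unit fundamental lemma IN THE STUB FRAME: integrality read off `hint`, then `n = min(2N+1, 2M)` with no extra hypothesis
# (Flicker 1998, §6 Thm. 18 p. 97; Rogawski 1990, §4.9 p. 55)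

Topic `NumberTheory/Rogawski1990`; namespace `Literature.NumberTheory.Rogawski1990`.  THEOREMS ONLY (no definition, no instance, no notation, no named fact, no `sorry`;
count-neutral).  Cell `pub/hodgecm-mathlib`, F0∕P3a road «D-N7-inert», line «N7nsCount» ED. 1.3 (architect A-p06 (g26)): the value-stub `stub_irredExponents` of
`stub_countIrredClause` CLOSED BY NAME — the three integrality premises `htr hdet hb` of ★ `exists_irredExponents` ∕ ★ `exists_valued_disc_eq_exp_neg_odd_of_not_exists_isRoot`
are READ OFF the stub's `hint` (integrality of the coefficients of `χ_{ι_v(γ_H),w} = χ_{g,w} · (X − u_w)`, ★ `charpoly_map_endoEmbLocal_apply`) and `v_w(u_w) = 1` (★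
`valued_finGammaTwo_apply_eq_one`).  HONEST LABEL: HC_CM is proved only modulo the printed citations until rung 0 closes.

THE MATHEMATICS.  `χ_{ι(γ_H),w} = (X² − t X + d)(X − u) = X³ − (t + u) X² + (d + u t) X − u d` with `t = tr g_w`, `d = det g_w`, `u = u_w` of valuation one; so
`t = −c₂ − u` and `d = −c₀ ∕ u` are integral when the coefficients `cᵢ` are (§1).  Then ★ FILE β gives `N` (`v_w(t² − 4d) = exp(−(2N+1))`, from `hirr`) and ★ ED. 2
gives `n, M` with `v_w(χ_g(u)_w) = exp(−n)`, `n = min(2N+1, 2M)` (**`exists_irredExponents_of_hint`**, §2).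

## References
* [Flicker1998UnitaryFL] Y. Z. Flicker, *Elementary proof of the fundamental lemma for a unitary group*, Canad. J. Math. 50 (1998), §6 Thm. 18 p. 97.
* [Rogawski1990] J. D. Rogawski, *Automorphic Representations of Unitary Groups in Three Variables*, Ann. of Math. Stud. 123 (1990), §4.9 p. 55, Prop. 4.9.1 (b).
-/

set_option autoImplicit false

noncomputable section

open Matrix NumberField IsDedekindDomain Polynomial
open scoped MatrixGroups Valued

namespace Literature.NumberTheory.Rogawski1990

open Literature.NumberTheory.Automorphic Literature.NumberTheory.Automorphic.UnitaryGroup Literature.NumberTheory.GaloisRepresentations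

variable (L : Type) [Field L] [NumberField L] [IsCMField L] (v : HeightOneSpectrum (𝓞 ↥(maximalRealSubfield L)))
  (w : PlacesOver L v) (hw : IsCMField.complexConj L • w.1 = w.1)
  (a : (cmDatum L 2 (Matrix.of fun i j : Fin 2 => if i.val + j.val + 1 = 2 then (1 : L) else 0)).Local v ×
      (cmDatum L 1 (Matrix.of fun i j : Fin 1 => if i.val + j.val + 1 = 1 then (1 : L) else 0)).Local v)

/-! ## §1 Integrality of `tr g_w`, `det g_w` from the integrality of `χ_{ι(γ_H),w}` -/

section Integrality

omit [IsCMField L] in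
/-- Coefficients of `(X² − tX + d)(X − u)`: `c₂ = −(t + u)`, `c₀ = −u d` (bookkeeping). [folklore] -/
private theorem coeff_quadratic_mul_X_sub_C (t d u : w.1.adicCompletion L) :
    ((X ^ 2 - C t * X + C d) * (X - C u)).coeff 2 = -(t + u) ∧ ((X ^ 2 - C t * X + C d) * (X - C u)).coeff 0 = -(u * d) := by
  have h : (X ^ 2 - C t * X + C d) * (X - C u) = X ^ 3 - C (t + u) * X ^ 2 + C (d + u * t) * X - C (u * d) := by
    simp only [map_add, map_mul]; ring
  rw [h]
  refine ⟨?_, ?_⟩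
  · simp only [coeff_sub, coeff_add, coeff_X_pow, coeff_C_mul, coeff_X, coeff_C]
    norm_num
  · simp only [coeff_sub, coeff_add, coeff_X_pow, coeff_C_mul, coeff_X, coeff_C]
    norm_num

include hw in
/-- **`tr g_w` and `det g_w` are integral when `χ_{ι_v(γ_H),w}` has integral coefficients** (the stub's `hint`): `χ_{ι(γ_H),w} = χ_{g,w}·(X − u_w)` (★ `charpoly_map_endoEmbLocal_apply`),
`χ_{g,w} = X² − tr·X + det`, `v_w(u_w) = 1` (★ `valued_finGammaTwo_apply_eq_one`), so `tr = −c₂ − u_w`, `det = −c₀∕u_w`. [cite: Rogawski1990, §4.9 p. 55] -/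
theorem valued_trace_le_one_and_valued_det_le_one_of_hint
    (hint : ∀ i : ℕ, ((((endoEmbLocal L v a).val : GL (Fin 3) (LocalRing L v)).val.map
        (Pi.evalRingHom (fun w' : PlacesOver L v => w'.1.adicCompletion L) w)).charpoly.coeff i) ∈ 𝒪[w.1.adicCompletion L]) :
    Valued.v ((a.1.val : GL (Fin 2) (LocalRing L v)).val.map
        (Pi.evalRingHom (fun w' : PlacesOver L v => w'.1.adicCompletion L) w)).trace ≤ 1 ∧
      Valued.v ((a.1.val : GL (Fin 2) (LocalRing L v)).val.map
        (Pi.evalRingHom (fun w' : PlacesOver L v => w'.1.adicCompletion L) w)).det ≤ 1 := by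
  set g := (a.1.val : GL (Fin 2) (LocalRing L v)).val.map (Pi.evalRingHom (fun w' : PlacesOver L v => w'.1.adicCompletion L) w) with hg
  set u := finGammaTwo L v a w with hu
  have hχ := charpoly_map_endoEmbLocal_apply L (w := w) (γH := a)
  rw [Matrix.charpoly_fin_two] at hχ
  obtain ⟨hc2, hc0⟩ := coeff_quadratic_mul_X_sub_C L v w g.trace g.det u
  have h2 := hint 2
  have h0 := hint 0
  rw [hχ, hc2] at h2
  rw [hχ, hc0] at h0
  replace h2 : Valued.v (-(g.trace + u)) ≤ 1 := (Valuation.mem_integer_iff _ _).1 h2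
  replace h0 : Valued.v (-(u * g.det)) ≤ 1 := (Valuation.mem_integer_iff _ _).1 h0
  have hvu : Valued.v u = 1 := valued_finGammaTwo_apply_eq_one L v a w hw
  refine ⟨?_, ?_⟩
  · -- `tr = −c₂ − u`
    have e : g.trace = -(-(g.trace + u)) - u := by ring
    rw [e]
    refine (Valuation.map_sub _ _ _).trans (max_le ?_ hvu.le)
    rw [Valuation.map_neg]; exact h2
  · -- `u · det` integral and `v(u) = 1`
    have h : Valued.v (u * g.det) ≤ 1 := by rw [← Valuation.map_neg]; exact h0
    rw [map_mul, hvu, one_mul] at h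
    exact h

end Integrality

/-! ## §2 The stub `stub_irredExponents` in the frame of `stub_countIrredClause` -/

section Stub

include hw in
/-- **THE TYPE-(2) EXPONENTS IN THE STUB FRAME, NO EXTRA HYPOTHESIS** (`stub_irredExponents` of line «N7nsCount» ED. 1.3): at a non-split `v` unramified in `L` with
`IsUnit (2 : 𝒪_w)`, for `γ_H` with integral `χ_{ι_v(γ_H),w}` (`hint`) and `χ_{g,w}` rootless in `L_w` (`hirr`), there are `n N M : ℕ` with `v_w(χ_g(u)_w) = exp(−n)`,
`v_w(disc χ_{g,w}) = exp(−(2N+1))` and `n = min(2N+1, 2M)` — ★ FILE β (`N`, odd order of the discriminant) + ★ ED. 2 `exists_irredExponents` (`n, M`) with §1's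
integrality. [cite: Flicker1998UnitaryFL, §6 Thm. 18 p. 97] [cite: Rogawski1990, §4.9 p. 55, Prop. 4.9.1 (b)] -/
theorem exists_irredExponents_of_hint (hv : Algebra.IsUnramifiedIn (𝓞 L) v.asIdeal) (h2 : IsUnit (2 : 𝒪[w.1.adicCompletion L]))
    (hint : ∀ i : ℕ, ((((endoEmbLocal L v a).val : GL (Fin 3) (LocalRing L v)).val.map
        (Pi.evalRingHom (fun w' : PlacesOver L v => w'.1.adicCompletion L) w)).charpoly.coeff i) ∈ 𝒪[w.1.adicCompletion L])
    (hirr : ¬ ∃ x : w.1.adicCompletion L, (((a.1.val : GL (Fin 2) (LocalRing L v)).val.map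
        (Pi.evalRingHom (fun w' : PlacesOver L v => w'.1.adicCompletion L) w)).charpoly).IsRoot x) :
    ∃ n N M : ℕ,
      Valued.v (((finCharpolyTwo L v a).eval (finGammaTwo L v a)) w) = WithZero.exp (-(n : ℤ)) ∧
      Valued.v (((a.1.val : GL (Fin 2) (LocalRing L v)).val.map
          (Pi.evalRingHom (fun w' : PlacesOver L v => w'.1.adicCompletion L) w)).trace ^ 2 -
        4 * ((a.1.val : GL (Fin 2) (LocalRing L v)).val.map
          (Pi.evalRingHom (fun w' : PlacesOver L v => w'.1.adicCompletion L) w)).det) = WithZero.exp (-((2 * N + 1 : ℕ) : ℤ)) ∧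
      n = min (2 * N + 1) (2 * M) := by
  obtain ⟨htr, hdet⟩ := valued_trace_le_one_and_valued_det_le_one_of_hint L v w hw a hint
  obtain ⟨N, hN⟩ := exists_valued_disc_eq_exp_neg_odd_of_not_exists_isRoot L v w hw hv h2 hirr htr hdet
  obtain ⟨n, M, hn, hlaw⟩ := exists_irredExponents L v w a h2 htr (valued_finGammaTwo_apply_eq_one L v a w hw).le hN
  exact ⟨n, N, M, hn, hN, hlaw⟩

include hw in
/-- **ARCHITECT'S SPELLING** (A-p06 (g26), ED. 1.3 `stub_irredExponents`): `∃ n N`, `v_w(χ_g(u)_w) = exp(−n)`, `v_w(disc χ_{g,w}) = exp(−(2N+1))`, `n ≤ 2N+1`, and `n` is EVEN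
unless `n = 2N + 1` (from `n = min(2N+1, 2M)`). [cite: Flicker1998UnitaryFL, §6 Thm. 18 p. 97] [cite: Rogawski1990, §4.9 p. 55, Prop. 4.9.1 (b)] -/
theorem exists_flicker_exponents_irred (hv : Algebra.IsUnramifiedIn (𝓞 L) v.asIdeal) (h2 : IsUnit (2 : 𝒪[w.1.adicCompletion L]))
    {γH : (cmDatum L 2 (Matrix.of fun i j : Fin 2 => if i.val + j.val + 1 = 2 then (1 : L) else 0)).Local v ×
      (cmDatum L 1 (Matrix.of fun i j : Fin 1 => if i.val + j.val + 1 = 1 then (1 : L) else 0)).Local v}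
    (hint : ∀ i : ℕ, ((((endoEmbLocal L v γH).val : GL (Fin 3) (LocalRing L v)).val.map
        (Pi.evalRingHom (fun w' : PlacesOver L v => w'.1.adicCompletion L) w)).charpoly.coeff i) ∈ 𝒪[w.1.adicCompletion L])
    (hirr : ¬ ∃ x : w.1.adicCompletion L, (((γH.1.val : GL (Fin 2) (LocalRing L v)).val.map
        (Pi.evalRingHom (fun w' : PlacesOver L v => w'.1.adicCompletion L) w)).charpoly).IsRoot x) :
    ∃ n N : ℕ,
      Valued.v (((finCharpolyTwo L v γH).eval (finGammaTwo L v γH)) w) = WithZero.exp (-(n : ℤ)) ∧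
      Valued.v (((γH.1.val : GL (Fin 2) (LocalRing L v)).val.map
          (Pi.evalRingHom (fun w' : PlacesOver L v => w'.1.adicCompletion L) w)).trace ^ 2 -
        4 * ((γH.1.val : GL (Fin 2) (LocalRing L v)).val.map
          (Pi.evalRingHom (fun w' : PlacesOver L v => w'.1.adicCompletion L) w)).det) = WithZero.exp (-((2 * N + 1 : ℕ) : ℤ)) ∧
      n ≤ 2 * N + 1 ∧ (Even n ∨ n = 2 * N + 1) := by
  obtain ⟨n, N, M, hn, hN, hlaw⟩ := exists_irredExponents_of_hint L v w hw γH hv h2 hint hirr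
  refine ⟨n, N, hn, hN, hlaw ▸ min_le_left _ _, ?_⟩
  rcases le_total (2 * N + 1) (2 * M) with h | h
  · exact Or.inr (hlaw.trans (min_eq_left h))
  · exact Or.inl ⟨M, by rw [hlaw, min_eq_right h]; ring⟩

end Stub

end Literature.NumberTheory.Rogawski1990

end
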